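import Summits.BirchSwinnertonDyer.BirchSwinnertonDyer.Theorems.GenusKolyvaginAtTwoPowDvdShaCardAtTwoRTRankDescentRankLeOne
import Literature.NumberTheory.EllipticCurves.SelmerProofs
import HarnessLib

/-!
# Route `GenusKolyvaginAtTwo`, crux U_T `ShaCardDvdPowAtTwoRT` (stmt-BirchSwinnertonDyer-23658) —
# KOLYVAGIN'S ANNIHILATION AND FINITENESS OF `Ш(E/K)[2^∞]` AT `2` ON THE HABITAT (McCallum 1991 §1 Theorem at `p = 2`,
# first two conjuncts; unconditional modulo the antecedent Q2)

Seat `bsd-line-gk2-p4` g22 (WIDTH-5 attach, cell `bsd-f1-sign2`), `--supports stmt-BirchSwinnertonDyer-23658` (helper; closes nothing).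
THEOREMS ONLY (no definition, no named fact, no `sorry`).  BSD is NOT proved by any of this; neither is U_T: U_T asks for the COUNT
`#Ш(E/K)[2^∞] ∣ 2^{2M₀}`, this file gives the ANNIHILATION `2^{M₀+2} · Ш(E/K)[2^∞] = 0` and the FINITENESS of `Ш(E/K)[2^∞]` — the part of
Kolyvagin's theorem that the item «contains» (refuter note on 23658: `Nat.card = 0` on an infinite group) and that the Literature framework
`KolyvaginDescent.card_sha_primaryComponent_le_of_localTerm` delivers only for `p ≠ 2`.

WHAT.  On U_T's frame (indeed on the smaller frame of gk2-p4 g21's `mordellWeilRank_baseChange_le_one_onHabitat`: `E/ℚ` globally minimal,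
non-CM, odd Tamagawa product, an odd prime of multiplicative reduction, `Δ < 0`, `ρ_{E,2^n}` onto for all `n`; `K` imaginary quadratic,
`d_K` odd `≠ −3`, Heegner, `d_K·(−|Δ|)`, `d_K·(−2|Δ|)` non-squares; a frame `(Dt, β, ι)`, a datum `d₁` of conductor `1` with
`2^{M₀+1} ∤ P(1)`; Q2 `KolyvaginRelationAtTwo` by name):
* `exists_two_pow_zsmul_selmer_mem_zmultiples_onHabitat` — at EVERY level `2^M`, `M ≥ 1`: `2^{M₀+2} • Sel_{2^M}(E/K) ⊆ ℤ · δ_M Q₀` for a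
  rational point `Q₀` (gk2-p4 g21 proved this inside `mordellWeilRank_baseChange_le_one_onHabitat` at the single level `M = 2M₀+5`; the
  laws (A)/(B) `…RTRankDescentLaws` and the algebra `zsmul_mem_zmultiples_of_exponent_laws` are level-uniform, and so is this corollary);
* `two_pow_zsmul_eq_zero_of_mem_sha_onHabitat` — every class of `Ш(E/K)` killed by a power of `2` is killed by `2^{M₀+2}`
  (`Sel_{2^M} ↠ Ш[2^M]`, Silverman X.4.2(a) = tree `map_torsionH1ToH1_selmerGroup_holds`; `δ_M Q₀ ↦ 0`);
* `sha_primaryComponent_two_onHabitat` — **`Ш(E/K)[2^∞]` is FINITE, `2^{M₀+2} • Ш(E/K)[2^∞] = 0`, and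
  `#Ш(E/K)[2^∞] ≤ #Sel_{2^{M₀+2}}(E/K)`** (`Ш[2^∞] = Ш[2^{M₀+2}]` is the image of the finite group `Sel_{2^{M₀+2}}`).
The infinite order of `y_K` is not used (non-divisibility replaces it); no `PubInputsAtTwo`, no Gross–Zagier, no Literature `kolyvagin`.

WHAT THIS DOES NOT DO.  The order bound of U_T (`#Ш ∣ 2^{2M₀}`) is McCallum's §5 telescope over all depths with SHARP laws; the laws used
here lose one bit per local pairing and see depth `≤ 2` only.  Q3R_T = U_T ∧ L_T (landed glue); L_T is closed (p744020).

References: [McCallumLMS1991] §1 Theorem, §5; [Kolyvagin1990] Thm. A; [GrossLMS1991] §2, §10; [SilvermanAEC2009] Thm. X.4.2(a).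
-/

set_option autoImplicit false
-- the Theorems namespace of this sub repeats the summit name by design (D-0017 nested layout)
set_option linter.dupNamespace false

noncomputable section

open scoped Classical
open scoped AddSubgroup

namespace Summit.BirchSwinnertonDyer.BirchSwinnertonDyer.Theorems.GenusExact.PlusDescent

open WeierstrassCurve NumberField IsDedekindDomain Field Literature.NumberTheory.EllipticCurves
  Literature.NumberTheory.GaloisRepresentations Literature.NumberTheory.EllipticCurves.ModularForms AddSubgroup
open Summit.BirchSwinnertonDyer.BirchSwinnertonDyer.Theses.GenusKolyvaginAtTwo (KolyvaginRelationAtTwo)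
open Summit.BirchSwinnertonDyer.Rank1Residual

/-! ## §1 The cyclic bound at every level `2^M` -/

/-- **`2^{M₀+2} • Sel_{2^M}(E/K)` is cyclic, carried by a Kummer class, at every level `M ≥ 1`** (U_T's habitat, modulo Q2): there is a
rational point `Q₀ ∈ E(K)` (a maximal `2`-power root of the Heegner point `P(1)` inside `E(K)`) such that every Selmer class
`x ∈ Sel_{2^M}(E/K)` has `2^{M₀+2} • x ∈ ℤ · δ_M Q₀`.  This is the level-uniform form of the step `hcyc` of gk2-p4 g21's
`mordellWeilRank_baseChange_le_one_onHabitat` (there `M = 2M₀+5`): laws (A)/(B) of `…RTRankDescentLaws` + `zsmul_mem_zmultiples_of_exponent_laws`.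
[cite: GrossLMS1991, §10 Claims 10.1, 10.3] [cite: McCallumLMS1991, §5] [cite: Kolyvagin1990, Thm. A] -/
theorem exists_two_pow_zsmul_selmer_mem_zmultiples_onHabitat (hQ2 : KolyvaginRelationAtTwo)
    (W : WeierstrassCurve ℚ) [W.IsElliptic] [W.IsGloballyMinimal] [NeZero (W.conductorNorm ℤ)] (hcm : ¬ W.HasCM)
    (hT : Odd W.tamagawaProduct) (v : HeightOneSpectrum (𝓞 ℚ)) (h2v : ((2 : ℕ) : 𝓞 ℚ) ∉ v.asIdeal)
    (hNv : ((W.conductorNorm ℤ : ℕ) : 𝓞 ℚ) ∈ v.asIdeal) (hmult : W.HasMultiplicativeReductionAt v) (hneg : W.Δ < 0)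
    (K : Type) [Field K] [NumberField K] (hIQ : IsImaginaryQuadratic K) (hodd : Odd (NumberField.discr K))
    (h3 : NumberField.discr K ≠ -3) (hHe : SatisfiesHeegnerHypothesis (W.conductorNorm ℤ) K)
    (hsq1 : ¬ IsSquare ((NumberField.discr K : ℚ) * -|W.Δ|)) (hsq2 : ¬ IsSquare ((NumberField.discr K : ℚ) * (-(2 * |W.Δ|))))
    (hρ : ∀ n : ℕ, 0 < n → W.HasSurjectiveModNGaloisRep ((2 : ℤ) ^ n))
    (Dt : ModularParametrizationData W (W.conductorNorm ℤ)) (β : ℤ) (ι : K →+* ℂ) (d₁ : KolyvaginHeegnerData Dt β ι 1) (M₀ : ℕ)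
    (hndiv : ¬ ∃ Q : (W.baseChange (ringClassField K ι 1)).toAffine.Point, ((2 ^ (M₀ + 1) : ℕ) : ℤ) • Q = d₁.derivedPoint)
    (M : ℕ) (hM : 1 ≤ M)
    (hdiv : ∀ P : geomPoints (W.baseChange K), ∃ Q : geomPoints (W.baseChange K), ((2 ^ M : ℕ) : ℤ) • Q = P) :
    ∃ Q₀ : (W.baseChange K).toAffine.Point, ∀ x ∈ selmerGroup (W.baseChange K) ((2 ^ M : ℕ) : ℤ),
      ((2 ^ (M₀ + 2) : ℕ) : ℤ) • x ∈ zmultiples (kummerMapTorsion (W.baseChange K) ((2 ^ M : ℕ) : ℤ) hdiv Q₀) := by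
  haveI : Fact (Nat.Prime 2) := ⟨Nat.prime_two⟩
  haveI : ∀ j : ℕ, NumberField (ringClassField K ι j) := JET.numberField_ringClassField K hIQ ι
  haveI hell : (W.baseChange K).IsElliptic := inferInstanceAs ((W.map (algebraMap ℚ K)).IsElliptic)
  -- ### numerics and currencies
  have hsurN : ∀ m : ℕ, W.HasSurjectiveModNGaloisRep ((2 ^ m : ℕ) : ℤ) :=
    MinimalTwinBSDTwo.forall_hasSurjectiveModNGaloisRep_two_pow_of_pos W hρ
  have hρN : ∀ m : ℕ, W.HasSurjectiveModNGaloisRep (2 ^ m : ℕ) := fun m ↦ by exact_mod_cast hsurN m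
  have hsurj1 : W.HasSurjectiveModNGaloisRep ((2 : ℤ) ^ 1) := hρ 1 one_pos
  have hs2 : W.HasSurjectiveModNGaloisRep 2 := by simpa using hsurj1
  have h2 : Module.finrank ℚ K = 2 := hIQ.1
  have hN : (W.conductorNorm ℤ) ≠ 0 := NeZero.ne _
  obtain ⟨τ, hτ, hττ⟩ := Literature.NumberTheory.EllipticCurves.exists_conj_of_isImaginaryQuadratic (K := K) hIQ
  have hw : -W.rootNumber = 1 ∨ -W.rootNumber = -1 := by
    rcases W.rootNumber_eq_one_or with h | h <;> simp [h]
  -- ### no `2`-torsion in `E(K)`; the Kummer map `δ` modulo `2^M`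
  have h2tors : ∀ P : (W.baseChange K).toAffine.Point, (2 : ℤ) • P = 0 → P = 0 := fun P hP ↦
    EigenClassesFinite.forall_zsmul_two_pow_baseChange_eq_zero_of_hasSurjectiveModNGaloisRep_two W K h2 hs2 1 P (by simpa using hP)
  set δ := kummerMapTorsion (W.baseChange K) ((2 ^ M : ℕ) : ℤ) hdiv with hδ
  have hker : δ.ker = (zsmulAddGroupHom (α := (W.baseChange K).toAffine.Point) ((2 ^ M : ℕ) : ℤ)).range :=
    kummerMapTorsion_ker (W.baseChange K) ((2 ^ M : ℕ) : ℤ) hdiv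
  have hker' : ∀ P : (W.baseChange K).toAffine.Point, δ P = 0 →
      ∃ R : (W.baseChange K).toAffine.Point, ((2 ^ M : ℕ) : ℤ) • R = P := fun P hP ↦ by
    have h : P ∈ δ.ker := (AddMonoidHom.mem_ker).mpr hP
    rw [hker] at h
    exact h
  have hδSel : ∀ P, δ P ∈ selmerGroup (W.baseChange K) ((2 ^ M : ℕ) : ℤ) := fun P ↦
    WeierstrassCurve.kummerMapTorsion_mem_selmerGroup (W.baseChange K) _ hdiv P
  -- ### the Heegner point `Ph ↦ P(1)`, its class `y = c_M(1) = δ Ph`, `2^{M₀+1} ∤ Ph`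
  obtain ⟨Ph, hPh, hPhmap⟩ := AdditiveKoly.exists_isHeegnerPoint_map_eq_derivedPoint_one (W := W) (K := K) (Dt := Dt) (β := β)
    (ι := ι) hIQ hHe d₁
  have hc1 : d₁.kolyvaginClass Nat.prime_two M = δ Ph :=
    VisiblePairAtTwo.kolyvaginClass_one_two_eq_kummerMapTorsion W K hIQ hodd hHe hsurj1 M d₁ Ph hPhmap
  have hP₀ : ∀ Q : (W.baseChange K).toAffine.Point, ((2 ^ (M₀ + 1) : ℕ) : ℤ) • Q ≠ Ph :=
    forall_two_pow_smul_ne_bottom_of_not_dvd_derivedPoint d₁ Ph hPhmap le_rfl hndiv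
  -- ### `Q₀ ∉ 2E(K)` with `2^{n₀} Q₀ = Ph`
  obtain ⟨n₀, Q₀, hn₀, hQ₀, hQ₀2⟩ : ∃ (n₀ : ℕ) (Q₀ : (W.baseChange K).toAffine.Point), n₀ ≤ M₀ ∧ ((2 ^ n₀ : ℕ) : ℤ) • Q₀ = Ph ∧
      ∀ R : (W.baseChange K).toAffine.Point, (2 : ℤ) • R ≠ Q₀ := by
    let Pdiv : ℕ → Prop := fun n ↦ ∃ Q : (W.baseChange K).toAffine.Point, ((2 ^ n : ℕ) : ℤ) • Q = Ph
    have hP0 : Pdiv 0 := ⟨Ph, by rw [pow_zero, Nat.cast_one, one_zsmul]⟩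
    obtain ⟨Q₀, hQ₀⟩ : Pdiv (Nat.findGreatest Pdiv M₀) := Nat.findGreatest_spec (Nat.zero_le M₀) hP0
    refine ⟨Nat.findGreatest Pdiv M₀, Q₀, Nat.findGreatest_le M₀, hQ₀, fun R hR ↦ ?_⟩
    have hP : ((2 ^ (Nat.findGreatest Pdiv M₀ + 1) : ℕ) : ℤ) • R = Ph := by
      rw [pow_succ, Nat.cast_mul, mul_smul]
      have h2R : ((2 : ℕ) : ℤ) • R = Q₀ := by exact_mod_cast hR
      rw [h2R, hQ₀]
    by_cases hlt : Nat.findGreatest Pdiv M₀ + 1 ≤ M₀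
    · exact Nat.findGreatest_is_greatest (Nat.lt_succ_self _) hlt ⟨R, hP⟩
    · have heq : Nat.findGreatest Pdiv M₀ = M₀ := by have := Nat.findGreatest_le (P := Pdiv) M₀; omega
      rw [heq] at hP
      exact hP₀ R hP
  set q := δ Q₀ with hqdef
  have hyq : δ Ph ∈ zmultiples q := by
    rw [← hQ₀, map_zsmul]
    exact zsmul_mem (mem_zmultiples q) _
  -- ### orders: `ord q = 2^M`, `ord y = 2^κ` with `M − M₀ ≤ κ`
  obtain ⟨mq, hmqM, hmq⟩ := exists_addOrderOf_galH1Torsion_eq_two_pow W K M q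
  have hmq_eq : mq = M := by
    by_contra hne
    have hlt : mq < M := lt_of_le_of_ne hmqM hne
    have h0 : ((2 ^ mq : ℕ) : ℤ) • q = 0 := (two_pow_zsmul_eq_zero_iff_of_addOrderOf W K hmq mq).mpr le_rfl
    obtain ⟨R, hR⟩ := hker' _ (by rw [map_zsmul]; exact h0)
    have hQ : Q₀ = ((2 ^ (M - mq) : ℕ) : ℤ) • R := eq_two_pow_zsmul_of_two_pow_zsmul_eq h2tors hmqM hR
    refine hQ₀2 (((2 ^ (M - mq - 1) : ℕ) : ℤ) • R) ?_
    rw [hQ, smul_smul]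
    congr 1
    push_cast
    rw [← pow_succ']
    congr 1
    omega
  rw [hmq_eq] at hmq
  obtain ⟨κ, hκM, hκ⟩ := exists_addOrderOf_galH1Torsion_eq_two_pow W K M (δ Ph)
  have hκge : M - M₀ ≤ κ := by
    by_contra hlt'
    have h0 : ((2 ^ κ : ℕ) : ℤ) • δ Ph = 0 := (two_pow_zsmul_eq_zero_iff_of_addOrderOf W K hκ κ).mpr le_rfl
    obtain ⟨R, hR⟩ := hker' _ (by rw [map_zsmul]; exact h0)
    have hPhR : Ph = ((2 ^ (M - κ) : ℕ) : ℤ) • R := eq_two_pow_zsmul_of_two_pow_zsmul_eq h2tors hκM hR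
    refine hP₀ (((2 ^ (M - κ - (M₀ + 1)) : ℕ) : ℤ) • R) ?_
    rw [hPhR, smul_smul]
    congr 1
    push_cast
    rw [← pow_add]
    congr 1
    omega
  -- ### the sign of `q`: `τ_* q = −w(E) • q` (Gross 5.3 transported to `Q₀`; odd torsion dies under `δ`)
  set τm := WeierstrassCurve.Affine.Point.map (W' := W) (τ : K →ₐ[ℚ] K) with hτm
  have hτq : conjAct W τ ((2 ^ M : ℕ) : ℤ) q = (-W.rootNumber) • q := by
    have hgross := X11b.KolyvaginBottom.isOfFinAddOrder_map_sub_neg_rootNumber_smul (W := W) hIQ hHe hPh τ hτ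
    have ht : IsOfFinAddOrder (τm Q₀ - (-W.rootNumber) • Q₀) := by
      refine isOfFinAddOrder_of_zsmul (n := ((2 ^ n₀ : ℕ) : ℤ)) (by positivity) ?_
      have heq : ((2 ^ n₀ : ℕ) : ℤ) • (τm Q₀ - (-W.rootNumber) • Q₀) = τm Ph - (-W.rootNumber) • Ph := by
        rw [smul_sub, ← map_zsmul, hQ₀, smul_comm, hQ₀]
      rw [heq]
      exact hgross
    obtain ⟨R, hR⟩ := exists_zsmul_two_pow_eq_of_odd_addOrderOf (W.baseChange K) M
      (odd_addOrderOf_of_forall_two_smul_eq_zero (W.baseChange K) h2tors ht)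
    have hδt : δ (τm Q₀ - (-W.rootNumber) • Q₀) = 0 := by
      have hmem : τm Q₀ - (-W.rootNumber) • Q₀ ∈ δ.ker := by
        rw [hker]
        exact ⟨R, hR⟩
      exact (AddMonoidHom.mem_ker).mp hmem
    rw [map_sub, map_zsmul, sub_eq_zero] at hδt
    rw [hqdef, conjAct_kummerMapTorsion W τ _ hdiv Q₀, ← hτm, hδt]
  -- ### (NPh_M) from the multiplicative prime
  have hNPh : ∀ z : galH1Torsion (W.baseChange K) ((2 ^ M : ℕ) : ℤ),
      (∀ ρ ∈ torsionFixing (W.baseChange K) ((2 ^ M : ℕ) : ℤ), h1Eval (W.baseChange K) ((2 ^ M : ℕ) : ℤ) z ρ = 0) →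
      (∀ w : HeightOneSpectrum (𝓞 K), z ∈ selmerLocalKer (W.baseChange K) (w.adicCompletion K) ((2 ^ M : ℕ) : ℤ)) → z = 0 :=
    fun z hz hzS ↦ NonPhantomPow.nonPhantomAtTwo_of_hasMultiplicativeReductionAt (W := W) (K := K) hT hρ hIQ hodd hsq1 hsq2 hN hHe
      h2v hNv hmult M hM z hz (fun w _ ↦ hzS w)
  -- ### the two laws, as `2^{M₀+1}`-annihilation
  have hbound : ∀ s : galH1Torsion (W.baseChange K) ((2 ^ M : ℕ) : ℤ),
      addOrderOf s * addOrderOf (d₁.kolyvaginClass Nat.prime_two M) ∣ 2 ^ (M + 1) → ((2 ^ (M₀ + 1) : ℕ) : ℤ) • s = 0 := by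
    intro s hs
    obtain ⟨a, -, ha⟩ := exists_addOrderOf_galH1Torsion_eq_two_pow W K M s
    rw [ha, hc1, hκ, ← pow_add, Nat.pow_dvd_pow_iff_le_right (by norm_num)] at hs
    exact (two_pow_zsmul_eq_zero_iff_of_addOrderOf W K ha (M₀ + 1)).mpr (by omega)
  have hB : ∀ s ∈ selmerGroup (W.baseChange K) ((2 ^ M : ℕ) : ℤ),
      conjAct W τ ((2 ^ M : ℕ) : ℤ) s = (-(-W.rootNumber)) • s → ((2 ^ (M₀ + 1) : ℕ) : ℤ) • s = 0 := by
    intro s hs hτs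
    rw [neg_neg] at hτs
    exact hbound s (addOrderOf_mul_addOrderOf_dvd_of_sign_rootNumber W K hQ2 hcm hρN hT hneg hIQ hodd h3 hHe hsq1 Dt β ι hM hτ hNPh d₁
      s hs hτs)
  have hA : ∀ s ∈ selmerGroup (W.baseChange K) ((2 ^ M : ℕ) : ℤ),
      conjAct W τ ((2 ^ M : ℕ) : ℤ) s = (-W.rootNumber) • s → Disjoint (zmultiples s) (zmultiples q) →
      ((2 ^ (M₀ + 1) : ℕ) : ℤ) • s = 0 := by
    intro s hs hτs hdisj
    refine hbound s (addOrderOf_mul_addOrderOf_dvd_of_sign_neg_rootNumber_of_disjoint W K hQ2 hcm hρN hT hneg hIQ hodd h3 hHe hsq1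
      Dt β ι hM hτ hNPh d₁ q (hδSel Q₀) hτq (by rw [hc1]; exact hyq) s hs hτs hdisj)
  -- ### the algebra: `2^{M₀+2} • Sel ⊆ ⟨q⟩`
  have hV : ∀ x : galH1Torsion (W.baseChange K) ((2 ^ M : ℕ) : ℤ), ((2 ^ M : ℕ) : ℤ) • x = 0 :=
    fun x ↦ zsmul_discreteH1_torsion ((2 ^ M : ℕ) : ℤ) x
  have hcyc := zsmul_mem_zmultiples_of_exponent_laws hV (conjAct W τ ((2 ^ M : ℕ) : ℤ))
    (fun x ↦ conjAct_conjAct_of_mul_self W hττ _ x) (selmerGroup (W.baseChange K) ((2 ^ M : ℕ) : ℤ))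
    (fun x hx ↦ conjAct_mem_selmerGroup W (fun w ↦ hIQ.2.isComplex w) τ _ hx) hw (hδSel Q₀) hmq hτq hB hA
  exact ⟨Q₀, hcyc⟩

/-! ## §2 Annihilation of the `2`-power torsion of `Ш(E/K)` -/

/-- **Kolyvagin's annihilation at `2` on U_T's habitat: every class of `Ш(E/K)` killed by a power of `2` is killed by `2^{M₀+2}`**
(modulo Q2).  Proof: a class `a ∈ Ш(E/K)` with `2^M a = 0` is the image of a Selmer class `x ∈ Sel_{2^M}(E/K)` (Silverman X.4.2(a),
tree `map_torsionH1ToH1_selmerGroup_holds`); `2^{M₀+2} x ∈ ℤ · δ_M Q₀` (§1) and `δ_M Q₀ ↦ 0` in `H¹(K, E)` (`torsionH1ToH1_kummerMapTorsion`).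
[cite: McCallumLMS1991, §1 Theorem] [cite: Kolyvagin1990, Thm. A] [cite: SilvermanAEC2009, Thm. X.4.2(a)] -/
theorem two_pow_zsmul_eq_zero_of_mem_sha_onHabitat (hQ2 : KolyvaginRelationAtTwo)
    (W : WeierstrassCurve ℚ) [W.IsElliptic] [W.IsGloballyMinimal] [NeZero (W.conductorNorm ℤ)] (hcm : ¬ W.HasCM)
    (hT : Odd W.tamagawaProduct) (v : HeightOneSpectrum (𝓞 ℚ)) (h2v : ((2 : ℕ) : 𝓞 ℚ) ∉ v.asIdeal)
    (hNv : ((W.conductorNorm ℤ : ℕ) : 𝓞 ℚ) ∈ v.asIdeal) (hmult : W.HasMultiplicativeReductionAt v) (hneg : W.Δ < 0)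
    (K : Type) [Field K] [NumberField K] (hIQ : IsImaginaryQuadratic K) (hodd : Odd (NumberField.discr K))
    (h3 : NumberField.discr K ≠ -3) (hHe : SatisfiesHeegnerHypothesis (W.conductorNorm ℤ) K)
    (hsq1 : ¬ IsSquare ((NumberField.discr K : ℚ) * -|W.Δ|)) (hsq2 : ¬ IsSquare ((NumberField.discr K : ℚ) * (-(2 * |W.Δ|))))
    (hρ : ∀ n : ℕ, 0 < n → W.HasSurjectiveModNGaloisRep ((2 : ℤ) ^ n))
    (Dt : ModularParametrizationData W (W.conductorNorm ℤ)) (β : ℤ) (ι : K →+* ℂ) (d₁ : KolyvaginHeegnerData Dt β ι 1) (M₀ : ℕ)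
    (hndiv : ¬ ∃ Q : (W.baseChange (ringClassField K ι 1)).toAffine.Point, ((2 ^ (M₀ + 1) : ℕ) : ℤ) • Q = d₁.derivedPoint)
    (M : ℕ) (a : (W.baseChange K).galH1) (ha : a ∈ (W.baseChange K).sha) (hMa : ((2 ^ M : ℕ) : ℤ) • a = 0) :
    ((2 ^ (M₀ + 2) : ℕ) : ℤ) • a = 0 := by
  haveI hell : (W.baseChange K).IsElliptic := inferInstanceAs ((W.map (algebraMap ℚ K)).IsElliptic)
  rcases Nat.eq_zero_or_pos M with rfl | hMpos
  · rw [pow_zero, Nat.cast_one, one_zsmul] at hMa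
    rw [hMa, zsmul_zero]
  · have hn : ((2 ^ M : ℕ) : ℤ) ≠ 0 := by positivity
    have hdiv : ∀ P : geomPoints (W.baseChange K), ∃ Q : geomPoints (W.baseChange K), ((2 ^ M : ℕ) : ℤ) • Q = P :=
      (W.baseChange K).zsmul_geomPoints_surjective_of_charZero hn
    obtain ⟨Q₀, hQ₀⟩ := exists_two_pow_zsmul_selmer_mem_zmultiples_onHabitat hQ2 W hcm hT v h2v hNv hmult hneg K hIQ hodd h3 hHe
      hsq1 hsq2 hρ Dt β ι d₁ M₀ hndiv M hMpos hdiv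
    have hmem : a ∈ (W.baseChange K).sha ⊓ torsionBy (W.baseChange K).galH1 ((2 ^ M : ℕ) : ℤ) :=
      AddSubgroup.mem_inf.mpr ⟨ha, by change ((2 ^ M : ℕ) : ℤ) • a = 0; exact hMa⟩
    rw [← WeierstrassCurve.map_torsionH1ToH1_selmerGroup_holds (W.baseChange K) hn] at hmem
    obtain ⟨x, hx, rfl⟩ := AddSubgroup.mem_map.mp hmem
    obtain ⟨k, hk⟩ := mem_zmultiples_iff.mp (hQ₀ x hx)
    rw [← map_zsmul, ← hk, map_zsmul, torsionH1ToH1_kummerMapTorsion, zsmul_zero]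

/-! ## §3 `Ш(E/K)[2^∞]` is finite, killed by `2^{M₀+2}`, of order at most `#Sel_{2^{M₀+2}}(E/K)` -/

/-- **Kolyvagin's theorem on `Ш(E/K)[2^∞]`, annihilation-and-finiteness form, AT `2` on U_T's habitat** (McCallum 1991 §1 Theorem, first
two conjuncts, with the lossy exponent `M₀ + 2`; modulo Q2 only): the `2`-primary part `Ш(E/K)[2^∞]` (Mathlib's
`AddCommGroup.primaryComponent`) is FINITE, is killed by `2^{M₀+2}`, and has order at most `#Sel_{2^{M₀+2}}(E/K)` — it equals
`Ш(E/K)[2^{M₀+2}]`, the image of the finite group `Sel_{2^{M₀+2}}(E/K)`.  The ORDER bound `#Ш(E/K)[2^∞] ∣ 2^{2M₀}` is U_T itself and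
is NOT proved here. [cite: McCallumLMS1991, §1 Theorem] [cite: Kolyvagin1990, Thm. A] [cite: SilvermanAEC2009, Thm. X.4.2(a), (b)] -/
theorem sha_primaryComponent_two_onHabitat (hQ2 : KolyvaginRelationAtTwo)
    (W : WeierstrassCurve ℚ) [W.IsElliptic] [W.IsGloballyMinimal] [NeZero (W.conductorNorm ℤ)] (hcm : ¬ W.HasCM)
    (hT : Odd W.tamagawaProduct) (v : HeightOneSpectrum (𝓞 ℚ)) (h2v : ((2 : ℕ) : 𝓞 ℚ) ∉ v.asIdeal)
    (hNv : ((W.conductorNorm ℤ : ℕ) : 𝓞 ℚ) ∈ v.asIdeal) (hmult : W.HasMultiplicativeReductionAt v) (hneg : W.Δ < 0)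
    (K : Type) [Field K] [NumberField K] (hIQ : IsImaginaryQuadratic K) (hodd : Odd (NumberField.discr K))
    (h3 : NumberField.discr K ≠ -3) (hHe : SatisfiesHeegnerHypothesis (W.conductorNorm ℤ) K)
    (hsq1 : ¬ IsSquare ((NumberField.discr K : ℚ) * -|W.Δ|)) (hsq2 : ¬ IsSquare ((NumberField.discr K : ℚ) * (-(2 * |W.Δ|))))
    (hρ : ∀ n : ℕ, 0 < n → W.HasSurjectiveModNGaloisRep ((2 : ℤ) ^ n))
    (Dt : ModularParametrizationData W (W.conductorNorm ℤ)) (β : ℤ) (ι : K →+* ℂ) (d₁ : KolyvaginHeegnerData Dt β ι 1) (M₀ : ℕ)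
    (hndiv : ¬ ∃ Q : (W.baseChange (ringClassField K ι 1)).toAffine.Point, ((2 ^ (M₀ + 1) : ℕ) : ℤ) • Q = d₁.derivedPoint) :
    Finite (AddCommGroup.primaryComponent (W.baseChange K).sha 2) ∧
    (∀ c ∈ AddCommGroup.primaryComponent (W.baseChange K).sha 2, 2 ^ (M₀ + 2) • c = 0) ∧
    Nat.card (AddCommGroup.primaryComponent (W.baseChange K).sha 2) ≤
      Nat.card (selmerGroup (W.baseChange K) ((2 ^ (M₀ + 2) : ℕ) : ℤ)) := by
  haveI hell : (W.baseChange K).IsElliptic := inferInstanceAs ((W.map (algebraMap ℚ K)).IsElliptic)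
  have hn : ((2 ^ (M₀ + 2) : ℕ) : ℤ) ≠ 0 := by positivity
  -- annihilation of the primary component
  have hkill : ∀ c ∈ AddCommGroup.primaryComponent (W.baseChange K).sha 2, 2 ^ (M₀ + 2) • c = 0 := by
    intro c hc
    obtain ⟨k, hk⟩ := (AddCommGroup.mem_primaryComponent).mp hc
    have hk' : ((2 ^ k : ℕ) : ℤ) • (c : (W.baseChange K).galH1) = 0 := by
      rw [natCast_zsmul, ← AddSubgroupClass.coe_nsmul, hk, ZeroMemClass.coe_zero]
    have h := two_pow_zsmul_eq_zero_of_mem_sha_onHabitat hQ2 W hcm hT v h2v hNv hmult hneg K hIQ hodd h3 hHe hsq1 hsq2 hρ Dt β ι d₁ M₀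
      hndiv k (c : (W.baseChange K).galH1) c.2 hk'
    rw [natCast_zsmul, ← AddSubgroupClass.coe_nsmul] at h
    exact_mod_cast h
  -- the finite group `Ш ⊓ H¹(K,E)[2^(M₀+2)]` = image of `Sel_{2^(M₀+2)}` (Silverman X.4.2(a), (b))
  have hT_eq : (selmerGroup (W.baseChange K) ((2 ^ (M₀ + 2) : ℕ) : ℤ)).map (torsionH1ToH1 (W.baseChange K) ((2 ^ (M₀ + 2) : ℕ) : ℤ)) =
      (W.baseChange K).sha ⊓ torsionBy (W.baseChange K).galH1 ((2 ^ (M₀ + 2) : ℕ) : ℤ) :=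
    WeierstrassCurve.map_torsionH1ToH1_selmerGroup_holds (W.baseChange K) hn
  haveI : Finite (selmerGroup (W.baseChange K) ((2 ^ (M₀ + 2) : ℕ) : ℤ)) := (W.baseChange K).finite_selmerGroup_holds hn
  have hφsurj : Function.Surjective
      ((torsionH1ToH1 (W.baseChange K) ((2 ^ (M₀ + 2) : ℕ) : ℤ)).addSubgroupMap (selmerGroup (W.baseChange K) ((2 ^ (M₀ + 2) : ℕ) : ℤ))) :=
    AddMonoidHom.addSubgroupMap_surjective _ _
  haveI hfinIm : Finite ((selmerGroup (W.baseChange K) ((2 ^ (M₀ + 2) : ℕ) : ℤ)).map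
      (torsionH1ToH1 (W.baseChange K) ((2 ^ (M₀ + 2) : ℕ) : ℤ))) := Finite.of_surjective _ hφsurj
  have hcardIm : Nat.card ((selmerGroup (W.baseChange K) ((2 ^ (M₀ + 2) : ℕ) : ℤ)).map
      (torsionH1ToH1 (W.baseChange K) ((2 ^ (M₀ + 2) : ℕ) : ℤ))) ≤ Nat.card (selmerGroup (W.baseChange K) ((2 ^ (M₀ + 2) : ℕ) : ℤ)) :=
    Nat.card_le_card_of_surjective _ hφsurj
  -- the injection `Ш[2^∞] ↪ Ш ⊓ H¹(K,E)[2^(M₀+2)]`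
  have hinj : ∃ f : AddCommGroup.primaryComponent (W.baseChange K).sha 2 →
      (selmerGroup (W.baseChange K) ((2 ^ (M₀ + 2) : ℕ) : ℤ)).map (torsionH1ToH1 (W.baseChange K) ((2 ^ (M₀ + 2) : ℕ) : ℤ)),
      Function.Injective f := by
    refine ⟨fun c ↦ ⟨((c.1 : (W.baseChange K).sha) : (W.baseChange K).galH1), ?_⟩, ?_⟩
    · rw [hT_eq]
      refine AddSubgroup.mem_inf.mpr ⟨(c.1 : (W.baseChange K).sha).2, ?_⟩
      have hc : 2 ^ (M₀ + 2) • (c.1 : (W.baseChange K).sha) = 0 := hkill c.1 c.2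
      change ((2 ^ (M₀ + 2) : ℕ) : ℤ) • ((c.1 : (W.baseChange K).sha) : (W.baseChange K).galH1) = 0
      rw [natCast_zsmul, ← AddSubgroupClass.coe_nsmul, hc, ZeroMemClass.coe_zero]
    · intro c₁ c₂ h
      exact Subtype.ext (Subtype.ext (Subtype.mk.inj h))
  obtain ⟨f, hf⟩ := hinj
  exact ⟨Finite.of_injective f hf, hkill, (Nat.card_le_card_of_injective f hf).trans hcardIm⟩

end Summit.BirchSwinnertonDyer.BirchSwinnertonDyer.Theorems.GenusExact.PlusDescent

end
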